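import Summits.HodgeConjecture.HodgeConjecture.Theorems.UeP4bLocalPeriodMatrix
import HarnessLib

/-!
# U-e P4 (B1b), FAMILY EDITION, part 1: the LOCAL PERIOD FORMULA `π = Δ · P_μ⁻¹ · P_λ` with chart-analytic `P`
# for ANY smooth projective family with quasi-projective base and total space

Cell hodgecm-mathlib (D-0151), rung 0 of the Mumford line under `HDel` (item `stmt-HodgeConjecture-24835`), (U)-lane node
U-e P4, PIECE EDITION (B-plan1 (g13) GO-PIECE 2026-08-29T18:25Z, lead B-p03 (g14): «P4 is local on the base» — the P4 chain
re-threaded over an open piece `ι : S′ → M ⊗ ℂ` smooth of pure dimension `d`, for the E-road «EQUIDIM from (F)»).  This file is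
★ `UeP4bLocalPeriodMatrix` §3 (`exists_local_periodMatrix`, stated for the complexified universal family `univFamilyℂ 𝓜` over
`M ⊗ ℂ`) made GENERIC IN THE FAMILY: `f : 𝒳 → S` any smooth projective family of relative dimension `g` with `S` and `𝒳`
quasi-projective and `S` smooth of pure dimension `d`, the marked abelian varieties `A_x = ((P′ x).A.fibre 𝟙).toAbelianVariety`
identified with the fibres `X_x` of `f` by ARBITRARY isomorphisms `εA x` (data), pinned on complex points as
`e x := homeomorphOfIso (εA x)`.  Instances: `f := univFamilyℂ 𝓜`, `εA x := fibreAVIso ≪≫ fiberUnivIso⁻¹` (★ p731131's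
statement), and the piece family `f := familyPullback.snd (univFamilyℂ 𝓜) ι`, `εA x := … ≪≫ fiberOverFamilyPullbackIso⁻¹`.
Nothing else changes: the proof of ★ p731131 used of the universal family only `(hf, hS, h𝒳)` and the pinned iso.  §1/§2
(currency transport, per-fibre marking) are imported from ★ `UeP4bLocalPeriodMatrix`.  HC_CM is proved only modulo the 7
printed citations until rung 0 closes; nothing in this file changes that count (a (U)-road leaf, books 0).

* `exists_local_periodMatrix_family` — around every `t₁ ∈ W` there are an open `W₂ ∋ t₁` inside `W` and inside the algebraic
  chart of `S` at `t₁`, and a matrix function `P` on `S(ℂ)`, analytic in that chart on `W₂`, with `det P(t)_μ ≠ 0` and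
  `π t = Δ · P(t)_μ⁻¹ · P(t)_λ` on `W₂` (Griffiths PINNED ★ `griffiths1968_holomorphicHodgeSubbundlesQP_algebraicChart` run on
  `f`; ★ `exists_ratTransport`; ★ `hodgeFrame_transport_of_iso` / `card_hodgeFrame_eq_dim_of_iso`; ★
  `siegelPoint_eq_of_hodgeFrame_of_apply_jOfSiegel`; ★ `latticeCoord_transport_eq_fixedFunctional'`; ★
  `analyticOnNhd_comp_algebraicChart_symm_of_univ`).

## References

* [VoisinHodgeI2002] C. Voisin, *Hodge Theory and Complex Algebraic Geometry I* (2002), §9.2.1, §10.1.2 Thm. 10.9, §10.2.1 Thm. 10.3.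
* [Griffiths1968PeriodsII] P. Griffiths, Periods of integrals on algebraic manifolds II, Amer. J. Math. 90 (1968), Thm. 1.1.
* [LangeBirkenhake1992] H. Lange, Ch. Birkenhake, *Complex Abelian Varieties* (1992), Ch. 8 §8.1 (Prop. 8.1.1).
* [MumfordFogartyKirwan1994] D. Mumford, J. Fogarty, F. Kirwan, *Geometric Invariant Theory* (3rd ed.), Appendix to Ch. 7 §A (p. 235).
-/

set_option autoImplicit false
set_option linter.dupNamespace false

noncomputable section

open CategoryTheory CategoryTheory.Limits AlgebraicGeometry Matrix Topology
open Literature.AlgebraicGeometry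
open scoped TensorProduct Manifold
open Literature.AlgebraicGeometry.Motives (SchemeOver ComplexPoints AlgPoints specOver AbelianVariety CartierDivisor fiberOver
  IsSmoothProjective ofRatClassBaseChange)
open Literature.AlgebraicGeometry.AbelianSchemes (PolarizedAbelianSchemeWithLevel AbelianSchemeOver)
open Literature.Geometry.Kaehler (ComplexTorus)
open Literature.Geometry.Kaehler.ComplexTorus (AHData periodMatrix intGram latticeGram IsRiemannForm proj picClass)
open Literature.NumberTheory.Transcendental (IsAnalytification)
open Literature.NumberTheory.Automorphic (siegelUpperHalfSpace)
open Literature.NumberTheory.Adeles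
open Literature.AlgebraicTopology.SingularHomology
open Literature.AlgebraicGeometry.ModuliOfAbelianVarieties
open Literature.AlgebraicGeometry.HodgeTheory

namespace Summit.HodgeConjecture.HodgeConjecture.Theorems

namespace UeP4bHodgeFrameMarkings

open SiegelModuli
/-! ### §3′ The local period formula (family edition) `π = Δ · P_μ⁻¹ · P_λ` near each point of `W`, `P` chart-analytic (Griffiths) -/

section Local

variable {g N : ℕ} {δ : Fin g → ℕ}

/-- **LOCAL PERIOD FORMULA, FAMILY EDITION.**  Setting of (B1b) without markings, for ANY smooth projective family
`f : 𝒳 → S` of relative dimension `g` with `S`, `𝒳` quasi-projective and `S` smooth of pure dimension `d` (the Griffiths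
input), an open `W ⊆ S(ℂ)` over which the family is cohomologically locally trivial, fibre triples `P′ x` with ARBITRARY
identifications `εA x : A_x ≅ X_x` (pinned on points as `e x := homeomorphOfIso (εA x)`), a frame
`γ` of `H¹` flat inside `W`, uniformisations `(Φ x, φ x)` of the `A_x` framing `γ x` through `e x`, and period points
`π x ∈ 𝔥_g` for which `Φ x` is `J(π x)`-linear.  CONCLUSION: around every `t₁ ∈ W` there are an open `W₂ ∋ t₁` inside `W`
and inside the algebraic chart of `S` at `t₁`, and a matrix function `P` on `S(ℂ)`, analytic in that chart on `W₂`, with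
`det P(t)_μ ≠ 0` and `π t = Δ · P(t)_μ⁻¹ · P(t)_λ` for all `t ∈ W₂`.  ROAD: Griffiths' holomorphic frame `wᵢ(t)` of
`F¹H¹(X_t)` read on `H¹(X_{t₁})` (★ `griffiths1968_holomorphicHodgeSubbundlesQP_algebraicChart`, run on `f`),
carried to `A_t` (★ `hodgeFrame_transport_of_iso`, `r = g` by ★ `card_hodgeFrame_eq_dim_of_iso`), whose
lattice-coordinate matrix computes `π t` (★ `siegelPoint_eq_of_hodgeFrame_of_apply_jOfSiegel`) and is, entrywise, a FIXED
functional of `wᵢ(t)` (★ `latticeCoord_transport_eq_fixedFunctional'`), hence analytic.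
[cite: VoisinHodgeI2002, §10.2.1 Thm. 10.3 and §10.1.2 Thm. 10.9] [cite: LangeBirkenhake1992, Ch. 8 §8.1 (Prop. 8.1.1)]
[cite: Griffiths1968PeriodsII, Thm. 1.1] -/
theorem exists_local_periodMatrix_family (hδ : IsPolarizationType δ) {𝒳 S : SchemeOver ℂ} (f : 𝒳 ⟶ S)
    (hf : Motives.IsSmoothProjectiveFamily f g) (hS : IsQuasiProjectiveOver S) (h𝒳 : IsQuasiProjectiveOver 𝒳)
    (d : ℕ) [SmoothOfRelativeDimension d S.hom] [LocallyOfFiniteType S.hom]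
    [IsLocallyNoetherian (specOver ℚ ℂ).left]
    {W : Set (ComplexPoints S)} (hWo : IsOpen W)
    (hU : IsCohomologicallyLocallyTrivialOn f W)
    (P' : W → PolarizedAbelianSchemeWithLevel g N δ (specOver ℚ ℂ).left)
    (εA : ∀ x : W, (W1.fibreAV (P' x)).X ≅ fiberOver f x.1)
    (γ : ∀ x : W, Fin g ⊕ Fin g →
      singularCohomology ℚ ℚ (ComplexPoints (fiberOver f x.1)) 1)
    (hflat : ∀ (x x' : W) (p : Path.Homotopic.Quotient x x') (a : Fin g ⊕ Fin g),
      transportFun f 1 hU p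
          (ofRatClass (ComplexPoints (fiberOver f x.1)) 1 (γ x a)) =
        ofRatClass (ComplexPoints (fiberOver f x'.1)) 1 (γ x' a))
    (Φ : ∀ _x : W, (Fin g ⊕ Fin g → ℝ) ≃L[ℝ] (Fin g → ℂ))
    (φ : ∀ x : W, C(ComplexTorus (Φ x), ((P' x).A.fibre (𝟙 (Spec (CommRingCat.of ℂ)))).toAbelianVariety.Points ℂ))
    (hφ : ∀ x : W, IsAnalytification (Fin g → ℂ)
      ((P' x).A.fibre (𝟙 (Spec (CommRingCat.of ℂ)))).toAbelianVariety.X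
      ((P' x).A.fibre (𝟙 (Spec (CommRingCat.of ℂ)))).toAbelianVariety.dim (φ x))
    (hframe : ∀ (x : W) (a : Fin g ⊕ Fin g),
      singularCohomology.map ℚ ℚ
          (((Motives.AlgPoints.homeomorphOfIso (L := ℂ)
              (εA x) :
              ((P' x).A.fibre (𝟙 (Spec (CommRingCat.of ℂ)))).toAbelianVariety.Points ℂ ≃ₜ
                ComplexPoints (fiberOver f x.1)) :
            C(((P' x).A.fibre (𝟙 (Spec (CommRingCat.of ℂ)))).toAbelianVariety.Points ℂ,
              ComplexPoints (fiberOver f x.1))).comp (φ x)) 1 (γ x a) =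
        latticeClass (Φ x) a)
    (π : W → Matrix (Fin g) (Fin g) ℂ) (hπ : ∀ x, π x ∈ siegelUpperHalfSpace g)
    (hJ : ∀ (x : W) (v : Fin g ⊕ Fin g → ℝ), Φ x (jOfSiegel δ (π x) *ᵥ v) = Complex.I • Φ x v) (t₁ : W) :
    ∃ W₂ : Set (ComplexPoints S), IsOpen W₂ ∧ t₁.1 ∈ W₂ ∧ W₂ ⊆ W ∧
      W₂ ⊆ (ComplexPoints.algebraicChart S d t₁.1).source ∧
      ∃ P : ComplexPoints S → Matrix (Fin g) (Fin g ⊕ Fin g) ℂ,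
        (∀ i a, AnalyticOnNhd ℂ
          ((fun y ↦ P y i a) ∘ (ComplexPoints.algebraicChart S d t₁.1).symm)
          (ComplexPoints.algebraicChart S d t₁.1 '' W₂)) ∧
        ∀ (t : ComplexPoints S) (ht : t ∈ W), t ∈ W₂ →
          IsUnit (P t).toCols₂.det ∧
            π ⟨t, ht⟩ = Matrix.diagonal (fun i ↦ (δ i : ℂ)) * ((P t).toCols₂)⁻¹ * (P t).toCols₁ := by
  classical
  -- the complexified universal family is a smooth projective family with quasi-projective base and total space
  have hUu : IsCohomologicallyLocallyTrivialOn f (Set.univ : Set (ComplexPoints S)) :=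
    isCohomologicallyLocallyTrivialOn_univ_of_isSmoothProjectiveFamily f d hf hS
  have hrat : ∀ (s t : (Set.univ : Set (ComplexPoints S))) (q : Path.Homotopic.Quotient s t)
      (α : complexBetti (fiberOver f s.1) 1), IsRationalClass α → IsRationalClass (transportFun f 1 hUu q α) :=
    fun s t q α hα ↦ isRationalClass_transportFun_of_isSmoothProjectiveFamily f 1 d hf hS q hα
  -- Hodge-symmetric Hodge models of the fibres
  have hBex : ∀ t : ComplexPoints S, ∃ B : HodgeModel g (fiberOver f t), B.IsHodgeSymmetric := fun t ↦ by
    obtain ⟨B, hB⟩ := exists_isReal_hodgeModel_holds g _ (hf.isSmoothProjective t)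
    exact ⟨B, hB.isHodgeSymmetric⟩
  choose B hB using hBex
  -- the marked abelian varieties, their identifications with the fibres, their dimension
  have hAdim : ∀ x : W, (W1.fibreAV (P' x)).dim = g := fun x ↦ W1.fibreAV_dim (P' x)
  have hAsp : ∀ x : W, IsSmoothProjective (W1.fibreAV (P' x)).dim (W1.fibreAV (P' x)).X := fun x ↦ AbelianVariety.isSmoothProjective_holds
  -- Griffiths, pinned chart, at `t₁`, reference fibre `t₁`, inside `W`
  set s₁ : (Set.univ : Set (ComplexPoints S)) := ⟨t₁.1, Set.mem_univ _⟩ with hs₁def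
  have hN : (Subtype.val ⁻¹' W : Set (Set.univ : Set (ComplexPoints S))) ∈ 𝓝 s₁ :=
    (hWo.preimage continuous_subtype_val).mem_nhds (show t₁.1 ∈ W from t₁.2)
  obtain ⟨W₂, hW₂o, hs₁W₂, hW₂N, hW₂pc, ψ, hW₂ψ, hψ, hGr⟩ :=
    griffiths1968_holomorphicHodgeSubbundlesQP_algebraicChart (f := f) (d := d) 1 hf hS h𝒳 hUu B hB s₁ s₁ _ hN
  obtain ⟨r, w, hframes, hanal⟩ := hGr (LinearEquiv.refl ℚ _)
    ⟨Path.Homotopic.Quotient.refl s₁, fun v ↦ by rw [LinearEquiv.refl_apply, transportFun_refl]⟩ 1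
  -- for every point of `W₂`: a path from `t₁` inside `W₂`, the rational transport along it, the frame at that point
  have hpt : ∀ t : (Set.univ : Set (ComplexPoints S)), t ∈ W₂ →
      ∃ (ε : Path s₁ t) (_ : ∀ u, ε u ∈ W₂)
        (T : singularCohomology ℚ ℚ (ComplexPoints (fiberOver f s₁.1)) 1 ≃ₗ[ℚ]
          singularCohomology ℚ ℚ (ComplexPoints (fiberOver f t.1)) 1),
        (∀ v, ofRatClass (ComplexPoints (fiberOver f t.1)) 1 (T v) =
          transportFun f 1 hUu ⟦ε⟧ (ofRatClass (ComplexPoints (fiberOver f s₁.1)) 1 v)) ∧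
        LinearIndependent ℂ (fun i ↦ w i t) ∧
          (((B t.1).hodgeStructure (hf.isSmoothProjective t.1) (hB t.1) 1).comapEquiv T).F 1 =
            Submodule.span ℂ (Set.range fun i ↦ w i t) := by
    intro t ht
    have hj : JoinedIn W₂ s₁ t := hW₂pc.joinedIn s₁ hs₁W₂ t ht
    obtain ⟨T, hT⟩ := exists_ratTransport f 1 hUu hrat ⟦hj.somePath⟧
    obtain ⟨hli, hF⟩ := hframes t ht hj.somePath hj.somePath_mem T
      (fun v ↦ by rw [LinearEquiv.refl_apply]; exact hT v)
    exact ⟨hj.somePath, hj.somePath_mem, T, hT, hli, hF⟩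
  -- `r = g` (at the base point)
  obtain ⟨ε₁, -, T₁, hT₁, hli₁, hF₁⟩ := hpt s₁ hs₁W₂
  have hrg : r = g := by
    rw [← hAdim t₁]
    exact card_hodgeFrame_eq_dim_of_iso (W1.fibreAV (P' t₁)) (hAsp t₁) (hf.isSmoothProjective s₁.1) (B s₁.1) (hB s₁.1) T₁ hF₁
      hli₁
      (εA t₁) (hAdim t₁)
  subst hrg
  -- the reference uniformisation `u₁ = e t₁ ∘ φ t₁` and the fixed lattice reading `L₁`
  set u₁ : ComplexTorus (Φ t₁) ≃ₜ ComplexPoints (fiberOver f t₁.1) :=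
    (IsHomeomorph.homeomorph (φ t₁) (hφ t₁).isHomeomorph).trans
      (Motives.AlgPoints.homeomorphOfIso (L := ℂ) (εA t₁)) with hu₁def
  have hu₁ : ∀ b, singularCohomology.map ℚ ℚ (u₁ : C(ComplexTorus (Φ t₁), ComplexPoints (fiberOver f t₁.1))) 1
      (γ t₁ b) = latticeClass (Φ t₁) b := fun b ↦ by
    have hcoe : (u₁ : C(ComplexTorus (Φ t₁), ComplexPoints (fiberOver f t₁.1))) =
        (((Motives.AlgPoints.homeomorphOfIso (L := ℂ) (εA t₁)) :
          ((P' t₁).A.fibre (𝟙 (Spec (CommRingCat.of ℂ)))).toAbelianVariety.Points ℂ ≃ₜ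
            ComplexPoints (fiberOver f t₁.1)) :
          C(((P' t₁).A.fibre (𝟙 (Spec (CommRingCat.of ℂ)))).toAbelianVariety.Points ℂ,
            ComplexPoints (fiberOver f t₁.1))).comp (φ t₁) :=
      ContinuousMap.ext fun _ ↦ rfl
    rw [hcoe]
    exact hframe t₁ b
  set L₁ : singularCohomology ℚ ℚ (ComplexPoints (fiberOver f s₁.1)) 1 →ₗ[ℚ] (Fin r ⊕ Fin r → ℚ) :=
    (latticeCoordHOne (Φ t₁)).toLinearMap ∘ₗ
      (singularCohomology.map ℚ ℚ (u₁ : C(ComplexTorus (Φ t₁), ComplexPoints (fiberOver f t₁.1))) 1).hom with hL₁def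
  -- the matrix function `P`
  set P : ComplexPoints S → Matrix (Fin r) (Fin r ⊕ Fin r) ℂ := fun y i b ↦
    TensorProduct.piScalarRight ℚ ℂ ℂ (Fin r ⊕ Fin r) (L₁.baseChange ℂ (w i ⟨y, Set.mem_univ y⟩)) b with hPdef
  refine ⟨Subtype.val '' W₂, isOpen_univ.isOpenMap_subtype_val _ hW₂o, ⟨s₁, hs₁W₂, rfl⟩, ?_, ?_, P, ?_, ?_⟩
  · rintro _ ⟨t, ht, rfl⟩; exact hW₂N ht
  · exact Motives.ComplexPoints.image_val_subset_algebraicChart_source_of_univ t₁.1 hψ hW₂ψ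
  · -- analyticity: `P y i b = Λ_{i,b} (w i y)` for the fixed functional `Λ_{i,b} = (·)_b ∘ piScalarRight ∘ (L₁ ⊗ ℂ)`
    intro i b
    set Λ : Module.Dual ℂ (ℂ ⊗[ℚ] singularCohomology ℚ ℚ (ComplexPoints (fiberOver f s₁.1)) 1) :=
      (LinearMap.proj b).comp ((TensorProduct.piScalarRight ℚ ℂ ℂ (Fin r ⊕ Fin r)).toLinearMap.comp (L₁.baseChange ℂ))
      with hΛdef
    have han := Motives.ComplexPoints.analyticOnNhd_comp_algebraicChart_symm_of_univ (fun y ↦ Λ (w i y)) t₁.1 hψ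
      (hanal i Λ)
    exact han
  · -- the formula and the non-vanishing at every point of `W₂`
    rintro t htW ⟨t', ht', rfl⟩
    obtain ⟨ε, hε, T, hT, hli, hF⟩ := hpt t' ht'
    have hε' : ∀ u, (ε u).1 ∈ W := fun u ↦ hW₂N (hε u)
    -- the frame carried to `A_t` ((S-3))
    obtain ⟨hli', hw'⟩ := hodgeFrame_transport_of_iso (hf.isSmoothProjective t'.1) (B t'.1) (hB t'.1) T hF hli
      (εA ⟨t'.1, htW⟩)
      (hAdim ⟨t'.1, htW⟩)
    -- its lattice-coordinate matrix IS `P t` ((S-4))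
    have hP : ∀ i b, P t'.1 i b = TensorProduct.piScalarRight ℚ ℂ ℂ (Fin r ⊕ Fin r)
        (((latticeCoordHOne (Φ ⟨t'.1, htW⟩)).toLinearMap ∘ₗ
            (singularCohomology.map ℚ ℚ (φ ⟨t'.1, htW⟩) 1).hom).baseChange ℂ
          ((singularCohomology.map ℚ ℚ
              (((Motives.AlgPoints.homeomorphOfIso (L := ℂ) (εA ⟨t'.1, htW⟩)) :
                  ((P' ⟨t'.1, htW⟩).A.fibre (𝟙 (Spec (CommRingCat.of ℂ)))).toAbelianVariety.Points ℂ ≃ₜ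
                    ComplexPoints (fiberOver f t'.1)) :
                C(((P' ⟨t'.1, htW⟩).A.fibre (𝟙 (Spec (CommRingCat.of ℂ)))).toAbelianVariety.Points ℂ,
                  ComplexPoints (fiberOver f t'.1))) 1).hom.baseChange ℂ
            (T.toLinearMap.baseChange ℂ (w i t')))) b := fun i b ↦
      (latticeCoord_transport_eq_fixedFunctional' f hUu hU γ hflat t₁.2 htW ε hε' T hT u₁ hu₁
        (Motives.AlgPoints.homeomorphOfIso (L := ℂ) (εA ⟨t'.1, htW⟩))
        (φ ⟨t'.1, htW⟩) (hframe ⟨t'.1, htW⟩) (w i t') b).symm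
    exact siegelPoint_eq_of_hodgeFrame_of_apply_jOfSiegel hδ.1 (hπ ⟨t'.1, htW⟩) (Φ ⟨t'.1, htW⟩) (hJ ⟨t'.1, htW⟩)
      (hAsp ⟨t'.1, htW⟩) (φ ⟨t'.1, htW⟩) (hφ ⟨t'.1, htW⟩)
      (by rw [Module.finrank_fintype_fun_eq_card, Fintype.card_fin]) _ hw' hli' (hP)

end Local

end UeP4bHodgeFrameMarkings

end Summit.HodgeConjecture.HodgeConjecture.Theorems

end
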